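import Literature.MathematicalPhysics.QuantumFieldTheory.Balaban1983to89.B12EuclCov567
import Literature.MathematicalPhysics.QuantumFieldTheory.Balaban1983to89.B12Ward414

/-!
# Bałaban CMP 109 (1987) §5 p. 293, (5.9): the Ward identity of the TWO-VARIABLE vacuum polarization tensor,
«Σ_μ ∂*_μ Π_{μν}(x − y) = Σ_ν ∂_ν Π_{μν}(x − y) = 0», typed as bookkeeping from the first Ward–Takahashi identity
(4.15) p. 284 «⟨(δ²/δB²)𝐄(1), B₁, ∂λ⟩ = 0» of the finite-volume functional (NAMED HYPOTHESIS) ⇒ the two slot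
identities of the Hessian kernel on the torus ⇒ the limit (5.1) (NAMED HYPOTHESIS) ⇒ (5.9) on `Z^d`; and, for the
one-variable kernel `K = Π(·, 0)`, its IDENTITY with the lineage's `B12Transverse536.WardFirst K` — which discharges
the hypothesis `hward` of `…B12EuclCov567.moment2_eq_of_limit_of_invariance`

CITATION HEADER (lean-in-tree rule 2026-08-18).
* Source: T. Bałaban, "Renormalization group approach to lattice gauge field theories. I. Generation of effective
  actions in a small field approximation and a coupling constant renormalization in four dimensions", Commun. Math.
  Phys. **109** (1987) 249–301, doi:10.1007/bf01215223 [Balaban1987RG1] (cell paper B12; held: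
  `paper:balaban1987-cmp109-rg-i-small-field`; PDF page = journal page − 248), §4 pp. 283–284 (4.8)–(4.15), §5
  p. 293 (5.8)–(5.10).  The sentences and displays quoted below were READ AS IMAGES by the author of this file on the
  300-dpi renders of the audit cell (`HOME/b2b-balaban-ref1/pages/1987-cmp109-rg-I-small-field/…-p035-x2.png` =
  p. 283, `…-p036-x2.png` = p. 284, `…-p045-x2.png` = p. 293; HOME = the cell folder
  `run/shared/lean/pub/pub-balaban/`) and agree with the lineage transcript `HOME/b2b-balaban-b03/B12s-transcript.md`;
  inside quotation marks nothing is altered.  Audit cell `pub-balaban`, unit `b2b-balaban-b03-g19` (PAPER SUB-CELL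
  B03 → B12 §§2–5 lineage, gen 19), node B12-WARD-59.  Imports only the lineage's own accepted modules
  `…B12EuclCov567` (gen 18: (5.6)–(5.8) from (5.1)/(5.2), the finite-volume field space `Λ → T → V`, the projections
  `π n : Pt d →+ Tn n`, `moment2_eq_of_limit_of_invariance`; through it `…B12Transl58`: `hessian_swap`,
  `eq121_finiteVolume`, `transl58_of_limit`, `apply_eq_apply_sub_zero`) and `…B12Ward414` (gen 5: the abstract
  (4.9) ⇒ (4.13) ⇒ (4.14) ⇒ (4.15)₁ chain `hessian_apply_generator_eq_zero`, `fderiv_eq_zero_of_generators`);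
  modifies nothing.
* Statements reproduced (verbatim).  p. 283 [PDF 35]: *"For a small gauge field V = exp iB, and a small gauge
  transformation v = exp iλ, B and λ small, we have V^v(b) = exp iλ(b₋) exp iB(b) exp(−iλ(b₊)) = …,"* (4.8)
  *"(1/i) log V^v(b) = … = B(b) + i[λ(b₋), B(b)] − g⁻¹(iad_{B(b)})(∂λ)(b) + …, where the dots denote terms of higher
  order in λ, and g⁻¹(z) = (−z)/(e^{−z} − 1) = 1 + ½z + k₂z² + …. … Now differentiate the equality (4.7) with
  respect to λ, at λ = 0. This gives the identity"* (4.9) *"⟨(δ/δB)𝐄(exp iB), i[λ(b₋), B(b)] − g⁻¹(iad_{B(b)})(∂λ)(b)⟩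
  = 0 holding for all 𝐠ᶜ-valued functions λ, and small, 𝐠ᶜ-valued configurations B. It is the fundamental identity
  expressing the gauge invariance of the function 𝐄."*  p. 284 [PDF 36]: *"We are interested in the above identities
  at B = 0, because such expressions only appear in the sum (4.6). This simplifies them in an essential way. Consider
  at first (4.10) at B = 0"* (4.13) *"⟨(δ²/δB²)𝐄(1), −∂λ, B₁⟩ + ⟨(δ/δB)𝐄(1), iad_{λ₋}B₁ − ½iad_{B₁}∂λ⟩ = 0. … Thus
  we have the first, very important consequence of the gauge invariance"* (4.14) *"(δ/δB)𝐄(1) = 0. This equality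
  simplifies the identities, and also the sum (4.6), we can drop the term with n = 1. We obtain the following set of
  Ward-Takahashi identities ⟨(δ²/δB²)𝐄(1), B₁, ∂λ⟩ = 0, …"* (4.15) *"for an arbitrary gauge function λ, and arbitrary
  gauge fields B₁, B₂, B₃."*  p. 293 [PDF 45]: *"The function Π is also translation invariant and symmetric, hence"*
  (5.8) *"Π_{μν}(x, y) = Π_{μν}(x − y), Π_{μν}(x) = Π_{νμ}(−x). The gauge invariance, expressed in the first identity
  (4.15), implies"* (5.9) *"Σ_μ ∂*_μ Π_{μν}(x − y) = Σ_ν ∂_ν Π_{μν}(x − y) = 0. The representation (4.37) yields the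
  following inequality"* (5.10) *"|Π_{μν}(x − y)| ≦ O(1)E₀ exp(−δ₁|x − y|),"*; and, in momentum space, (5.15)
  *"Σ_μ ∂_μ(−ζ)Π_{μν}(ζ) = Σ_ν ∂_ν(ζ)Π_{μν}(ζ) = 0, where ∂_μ(ζ) = e^{iζ_μ} − 1."*  ((5.1) *"Π(b, b′) =
  lim_{T₁^{(j)}↗Z⁴} δ²/(δB(b)δB(b′)) 𝐄^{(j)}(U_j(exp iB))|_{B=0}"*, p. 292, is quoted in full in the header of
  `…B12Transl58`.)
* Proof route.  Print derives (5.9) in the one word «implies», from (4.15)₁ for the finite-volume functional whose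
  Hessian at `B = 0` is the tensor before the limit (5.1); no argument is displayed.  The standard argument: (4.15)₁
  says that the Hessian `D²f(0)` of `f = 𝐄^{(j)}(U_j(exp i·))` at the unit configuration annihilates, in one slot,
  every PURE GAUGE `∂λ`, `(∂λ)_ν(y) = λ(y + e_ν) − λ(y)` (the lattice gradient on positively oriented bonds
  `⟨y, y + e_ν⟩`; by (4.8) the generator of the gauge action at `B = 0` is `X_λ(0) = −∂λ`); taking for `λ` a delta
  function at the site `y₀` with charge direction `w`, `∂λ = Σ_ν (e_{ν, y₀−e_ν, w} − e_{ν, y₀, w})` in the bond basis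
  `e_{ν,y,w} = Pi.single ν (Pi.single y w)`, so by linearity of `D²f(0)(u, ·)`:
  `Σ_ν [H_{μν}(x, y₀ − e_ν) − H_{μν}(x, y₀)] = 0` for the Hessian kernel `H_{μν}(x, y) = D²f(0)(e_{μ,x,v}, e_{ν,y,v})`
  (a backward difference in the SECOND variable), and by the symmetry of second derivatives (Schwarz, `𝕜 = ℝ, ℂ`)
  `Σ_μ [H_{μν}(x₀ − e_μ, y) − H_{μν}(x₀, y)] = 0` (FIRST variable).  Both are finite sums of values of the kernel, so
  they pass to the pointwise limit (5.1) along projections `π n : Z^d →+ Tn n` (with `e_μ ↦ π n e_μ`, `map_sub`), and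
  on `Z^d`, for the one-variable kernel `K_{μν}(z) = Π_{μν}(z, 0)` of (5.8)₁: the first-variable identity AT `y = 0`
  is literally `Σ_μ (K_{μν}(x − e_μ) − K_{μν}(x)) = 0` = `Σ_μ ∂*_μΠ_{μν} = 0` = the lineage's `WardFirst K` (no
  translation invariance needed), and the second-variable identity is, under (5.8)₁, `Σ_ν (K_{μν}(z + e_ν) − K_{μν}(z))
  = 0` = `Σ_ν ∂_νΠ_{μν} = 0` = `B12WardLeadingForm.WardB₂` for the complexified kernel.  This module supplies exactly
  that, as elementary algebra/analysis (the author of this file's own short arguments, `[folklore]`), with (4.15)₁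
  entering ONLY as the named hypothesis `h415` on an abstract `C²` function of the finite-volume field (or, one step
  upstream, as infinitesimal invariance `hinv` along abstract generator fields `X_λ` with `X_λ(0) = −∂λ` and (4.14)
  `h414`, via `…B12Ward414`), and (5.1) ONLY as the named hypothesis `hlim` of `…B12Transl58` (pointwise limit along
  an arbitrary non-trivial filter of volumes).

WHY THIS NODE (the DAG edge it closes).  Gen 18 (`…B12EuclCov567.moment2_eq_of_limit_of_invariance`) reached (4.43),
(4.45) and `Σ_y Π = 0` for print's two-variable Π(x, y) straight from the INVARIANT FUNCTIONAL on the tori (per volume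
a `C²` function `f n` of the bond field invariant under translations, direction permutations and reflections) + the
limit (5.1), but still ASSUMED, for the one-variable kernel `K = Π(·, 0)`, the Ward identity (5.9)₁ `WardFirst K` as
the hypothesis `hward` («(5.9) from (4.15)₁ at the two-variable level» was listed there under WHAT IS NOT PROVED;
`…B12Covariance54` §6 has the dictionary (4.15)₁ ↔ (5.9) only for ONE-VARIABLE kernels on `Z^d`, at the level of the
quadratic form (5.43) on finitely supported fields — `wardFirst_iff_gauge_left`, `wardB₂_iff_gauge_right`).  This
module types print's own route for (5.9) — finite volume (4.15)₁ ⇒ the slot identities of the Hessian kernel, then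
the limit (5.1), then (5.8)₁ — so that in the end-to-end statement only (5.10) (the decay, from (4.37)) remains as a
hypothesis on `K` (`moment2_eq_of_limit_of_gaugeInvariance`: from the invariant functional on the tori + (4.15)₁ for
it, straight to (4.43)).  As for the Euclidean symmetries (gens 17, 18), a TERMWISE Ward identity of the polymer
functions `𝐄²(X, x, y)` of (4.37) would not do (the localized terms are not separately gauge invariant in the needed
form); the TOTAL functional (5.1) with its identity (4.15)₁ is the printed carrier.

DICTIONARY (paper ↦ Lean).
* directions `μ = 1, …, d` ↦ `Λ` (abstract at finite volume; `Fin d` on `Z^d`); sites of the torus `T₁^{(j)}` ↦ an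
  arbitrary FINITE additive group `T`, sites of `Z^d` ↦ `Pt d = Fin d → ℤ`; the unit vectors `e_ν` of the torus ↦ an
  abstract `e : Λ → T` (for the volumes of (5.1): `e ν = π n (unitVec ν)`); a bond field `B_ν(y) = B(⟨y, y + e_ν⟩)`
  with values in the charge space `V` (a normed space; print: `𝐠ᶜ`) ↦ `B : Λ → T → V`; `𝐄(1)`-centred functional
  `B ↦ 𝐄^{(j)}(U_j(exp iB))` ↦ an abstract `C²` function `f : (Λ → T → V) → F`.
* a gauge function `λ` ↦ `lam : T → V`; its gradient «∂λ», `(∂λ)(b) = λ(b₊) − λ(b₋)` on `b = ⟨y, y + e_ν⟩` ↦ the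
  bond field `fun ν y => lam (y + e ν) - lam y`; «B₁» ↦ an arbitrary direction `u : Λ → T → V`; (4.15)₁
  «⟨(δ²/δB²)𝐄(1), B₁, ∂λ⟩ = 0» ↦ `h415 : ∀ u lam, fderiv 𝕜 (fderiv 𝕜 f) 0 u (fun ν y => lam (y + e ν) - lam y) = 0`;
  the gauge generator of (4.8)/(4.9) ↦ an abstract field `X : E → E` with `X 0 = -(∂λ)` and
  `hinv : ∀ᶠ B in 𝓝 0, fderiv 𝕜 f B (X B) = 0` (the spelling of `…B12Ward414`); (4.14) ↦ `h414 : fderiv 𝕜 f 0 = 0`.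
* `δ/δB_μ(x)` in the charge direction `v` ↦ the Fréchet derivative in the direction `Pi.single μ (Pi.single x v)`;
  the finite-volume tensor ↦ `H μ ν x y = fderiv 𝕜 (fderiv 𝕜 f) 0 (Pi.single μ (Pi.single x v)) (Pi.single ν
  (Pi.single y v))` (hypothesis `hH`, the spelling of `…B12Transl58`/`…B12EuclCov567`); (5.1) ↦ the hypothesis
  `hlim : ∀ μ ν x y, Tendsto (fun n ↦ Πv n μ ν (π n x) (π n y)) l (𝓝 (Π μ ν x y))`.
* «∂*_μ» (backward difference, in the FIRST variable) ↦ `Π μ ν (x - unitVec μ) y - Π μ ν x y`; «∂_ν» acting on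
  `Π_{μν}(x − y)` through the SECOND variable ↦ `Π μ ν x (y - unitVec ν) - Π μ ν x y` (a backward step in `y` is a
  forward step in `z = x − y`); (5.9)₁ for `K μ ν z := Π μ ν z 0` ↦ `B12Transverse536.WardFirst K` (`Σ_μ (K μ ν (x −
  e_μ) − K μ ν x) = 0`), complex reading `B12Transverse536.WardB (ofRealK K)` (`PeriodicGleason.delta`); (5.9)₂ ↦
  `∀ μ z, Σ_ν (K μ ν (z + e_ν) − K μ ν z) = 0`, complex reading `B12WardLeadingForm.WardB₂ (ofRealK K)`
  (`B12Rep537.fdelta`).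

WHAT IS PROVED (kernel-checked, no `sorry`, standard axioms; every declaration is `[folklore]` algebra/analysis ABOUT
the printed objects, or carries the printed locus it transcribes; the module is definition-free).
1. §1 (limits, any finite direction type, any point type, values in a Hausdorff topological additive group, any
   `NeBot` filter of volumes): `sum_sub_fst_of_tendsto`, `sum_sub_snd_of_tendsto` — an identity
   `Σ_μ (Πₙ μ ν (s_μ x) y − Πₙ μ ν x y) = 0` (resp. in the second variable) holding for all `n` passes to the
   pointwise limit.
2. §2 (finite volume, (4.15)₁ ⇒ the slot identities): `hessian_apply_eq_zero_of_generator` /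
   `hessian_apply_eq_zero_of_generators` (abstract normed space: infinitesimal invariance along a generator field `X`
   with `X 0 = −g` + (4.14), resp. + detecting linear generators, ⇒ `D²f(0)(u, g) = 0` — (4.9) ⇒ (4.15)₁ for the
   direction `g = ∂λ`, by `…B12Ward414`); `grad_single` (the gradient of the delta function `Pi.single y₀ w` in the
   direction `ν` is `Pi.single (y₀ − e_ν) w − Pi.single y₀ w`); `hessian_ward_snd` ((4.15)₁ ⇒ `Σ_ν [D²f(0)(u,
   e_{ν,y₀−e_ν,w}) − D²f(0)(u, e_{ν,y₀,w})] = 0`, pure linearity — the site group `T` need not even be finite);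
   `ward_snd_kernel` (the same for the kernel `H`:
   `Σ_ν (H μ ν x (y − e ν) − H μ ν x y) = 0`); `ward_fst_kernel` (`𝕜 = ℝ, ℂ`, `f` `C²` at `0`: `Σ_μ (H μ ν (x − e μ) y −
   H μ ν x y) = 0`, via `hessian_swap`); `ward415_finiteVolume` (both); `h415_of_gaugeGenerators` ((4.15)₁ in the
   `h415` spelling from generator fields `X_λ` with `X_λ(0) = −∂λ`, `hinv`, `h414`).
3. §3 (on `Z^d`, the one-variable kernel): `wardFirst_of_twoVariable` — the first-variable identity ⇒ `WardFirst K`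
   (at `y = 0`; no translation invariance); `twoVariable_fst_iff_wardFirst` — ⇔ under (5.8)₁;
   `wardSnd_kernel_of_twoVariable` — the second-variable identity + (5.8)₁ ⇒ (5.9)₂ `Σ_ν (K μ ν (z + e_ν) − K μ ν z)
   = 0`, and `twoVariable_snd_iff_wardSnd` — ⇔ under (5.8)₁; `wardB₂_ofRealK` — its complex reading `WardB₂ (ofRealK K)`
   (and `wardB_ofReal` of `…B12Transverse536` is the complex reading of (5.9)₁).
4. §3, continued (the limit): `ward59_of_limit` — the two slot identities for torus kernels `Πv n` (steps `π n (unitVec μ)`) +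
   (5.1) ⇒ both two-variable identities (5.9) on `Z^d`; `moment2_eq_of_limit_ward` — v3 of gen 17/18's END TO END
   with `hward` DISCHARGED from the finite-volume slot identity: (5.1) + finite-volume translation invariance,
   symmetry, `r_π`- and `ε`-covariance, first-variable Ward identity + for `K` ONLY (5.10) `Decay510` ⇒ (4.43), (4.45),
   `Σ_y Π = 0`.
5. §4 (from the functional, `𝕜 = ℝ`): `ward59_of_limit_of_gaugeInvariance` — per volume a `C²` function `f n` of
   `B : Fin d → Tn n → V` satisfying (4.15)₁ (`h415`, gradient steps `π n (unitVec ν)`), `Πv n` ITS Hessian kernel at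
   `0`, (5.1) ⇒ both identities (5.9) on `Z^d` and `WardFirst K`; `eq59_of_limit_of_gaugeInvariance` — adding
   translation invariance of `f n`: (5.9)₁ AND (5.9)₂ for `K`, real and complex readings;
   `moment2_eq_of_limit_of_gaugeInvariance` — END TO END FROM (5.2) + (4.15)₁: `f n` invariant under translations,
   direction permutations and reflections and satisfying (4.15)₁ + (5.1) + for `K` only (5.10) ⇒ (4.43)
   `Σ_y Π_{μν}(x, y)(y_κ − x_κ)(y_τ − x_τ) = β(δ_{μκ}δ_{ντ} + δ_{μτ}δ_{νκ} − 2δ_{μν}δ_{κτ})`, (4.45) `Σ_y Π_{μν}(x, y)(y_κ −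
   x_κ) = 0` and `Σ_y Π_{μν}(x, y) = 0` — `…B12EuclCov567.moment2_eq_of_limit_of_invariance` with `hward` discharged.

WHAT IS NOT PROVED HERE (and not claimed).  (4.15)₁ itself for the ACTUAL functional of the paper — i.e. the gauge
invariance (4.7) of `𝐄^{(j)}(U_j(·))`, the expansion (4.8) of the lattice gauge action producing the generator
`X_λ` with `X_λ(0) = −∂λ`, and (4.14) from the semisimplicity of `G` — enters as the hypothesis `h415` (or `hinv`,
`hX0`, `h414`; the abstract implications (4.9) ⇒ (4.13) ⇒ (4.14) ⇒ (4.15)₁ are `…B12Ward414`, the Lie-algebraic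
detecting property is its §Lie); the existence of the limit (5.1) and the identification of the series (4.37) with
it — hypotheses, exactly as asserted in print; that the actual functional is `C²` (`hf`); (5.10) from (4.37) (stays
the hypothesis `h510`; cf. `…B12Transl58.decay510_tsum437`); the momentum-space form (5.15) (the lineage's (5.15) ↔
(5.9) dictionary is `…B12Rep537`/`…B12Transverse536`, untouched here); the higher identities (4.15)₂,₃; the colour
structure `δ^{ab}`.

HONEST FRAMING: value = kernel certificate of one displayed line of printed bookkeeping ((5.9) from (4.15)₁, at
finite volume and in the limit) plus the by-name discharge of one hypothesis inside the lineage's DAG; NOT a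
reproduction of any estimate of the paper, NOT summit progress (the host summit — continuum Yang–Mills with mass gap —
is untouched).
-/

namespace Literature.MathematicalPhysics.QuantumFieldTheory.Balaban1983to89.B12Ward59

open Literature.MathematicalPhysics.QuantumFieldTheory.GawedzkiKupiainen1985.PeriodicGleason (Pt unitVec)
open Literature.MathematicalPhysics.QuantumFieldTheory.Balaban1983to89.B12Sec2to5 (Decay510)
open Literature.MathematicalPhysics.QuantumFieldTheory.Balaban1983to89.B12Rep537 (ofReal fdelta)
open Literature.MathematicalPhysics.QuantumFieldTheory.Balaban1983to89.B12Form543 (ofRealK)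
open Literature.MathematicalPhysics.QuantumFieldTheory.Balaban1983to89.B12Transverse536 (WardFirst WardB rsgn
  wardB_ofReal)
open Literature.MathematicalPhysics.QuantumFieldTheory.Balaban1983to89.B12WardLeadingForm (WardB₂)
open Literature.MathematicalPhysics.QuantumFieldTheory.Balaban1983to89.B12Marginal444 (kdA)
open Literature.MathematicalPhysics.QuantumFieldTheory.Balaban1983to89.B12Covariance54 (permPt twist)
open Literature.MathematicalPhysics.QuantumFieldTheory.Balaban1983to89.B12Transl58 (apply_eq_apply_sub_zero
  hessian_swap eq121_finiteVolume transl58_of_limit)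
open Literature.MathematicalPhysics.QuantumFieldTheory.Balaban1983to89.B12EuclCov567
  (moment2_eq_of_limit_cov moment2_eq_of_limit_of_invariance)
open Literature.MathematicalPhysics.QuantumFieldTheory.Balaban1983to89.B12Ward414 (hessian_apply_generator_eq_zero
  fderiv_eq_zero_of_generators)
open Filter
open _root_.Topology

/-! ## §1 Finite-sum difference identities of two-variable kernels pass to pointwise limits -/

section Limit

variable {Λ X α : Type*} [Fintype Λ] [TopologicalSpace α] [T2Space α] [AddCommGroup α] [IsTopologicalAddGroup α]
  {ι : Type*} {l : Filter ι} [l.NeBot]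

/-- **A first-variable identity `Σ_μ (Πₙ μ ν (s_μ x) y − Πₙ μ ν x y) = 0` passes to pointwise limits** (Hausdorff
values, any non-trivial filter of volumes): finite sums and differences are continuous. [folklore] (the step
(4.15)₁-at-finite-volume ⇒ (5.9)₁ through the limit (5.1) p.292 of Balaban1987RG1) -/
theorem sum_sub_fst_of_tendsto {Pn : ι → Λ → Λ → X → X → α} {P : Λ → Λ → X → X → α} (s : Λ → X → X)
    (hWn : ∀ n ν x y, ∑ μ, (Pn n μ ν (s μ x) y - Pn n μ ν x y) = 0)
    (hlim : ∀ μ ν x y, Tendsto (fun n => Pn n μ ν x y) l (𝓝 (P μ ν x y))) (ν : Λ) (x y : X) :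
    ∑ μ, (P μ ν (s μ x) y - P μ ν x y) = 0 := by
  have h1 : Tendsto (fun n => ∑ μ, (Pn n μ ν (s μ x) y - Pn n μ ν x y)) l
      (𝓝 (∑ μ, (P μ ν (s μ x) y - P μ ν x y))) :=
    tendsto_finsetSum _ fun μ _ => (hlim μ ν (s μ x) y).sub (hlim μ ν x y)
  have h2 : Tendsto (fun n => ∑ μ, (Pn n μ ν (s μ x) y - Pn n μ ν x y)) l (𝓝 0) :=
    tendsto_const_nhds.congr fun n => (hWn n ν x y).symm
  exact tendsto_nhds_unique h1 h2

/-- **A second-variable identity `Σ_ν (Πₙ μ ν x (s_ν y) − Πₙ μ ν x y) = 0` passes to pointwise limits.** [folklore]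
(the step (4.15)₁-at-finite-volume ⇒ (5.9)₂ through the limit (5.1) p.292 of Balaban1987RG1) -/
theorem sum_sub_snd_of_tendsto {Pn : ι → Λ → Λ → X → X → α} {P : Λ → Λ → X → X → α} (s : Λ → X → X)
    (hWn : ∀ n μ x y, ∑ ν, (Pn n μ ν x (s ν y) - Pn n μ ν x y) = 0)
    (hlim : ∀ μ ν x y, Tendsto (fun n => Pn n μ ν x y) l (𝓝 (P μ ν x y))) (μ : Λ) (x y : X) :
    ∑ ν, (P μ ν x (s ν y) - P μ ν x y) = 0 := by
  have h1 : Tendsto (fun n => ∑ ν, (Pn n μ ν x (s ν y) - Pn n μ ν x y)) l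
      (𝓝 (∑ ν, (P μ ν x (s ν y) - P μ ν x y))) :=
    tendsto_finsetSum _ fun ν _ => (hlim μ ν x (s ν y)).sub (hlim μ ν x y)
  have h2 : Tendsto (fun n => ∑ ν, (Pn n μ ν x (s ν y) - Pn n μ ν x y)) l (𝓝 0) :=
    tendsto_const_nhds.congr fun n => (hWn n μ x y).symm
  exact tendsto_nhds_unique h1 h2

end Limit

/-! ## §2 Finite volume: (4.15)₁ «⟨(δ²/δB²)𝐄(1), B₁, ∂λ⟩ = 0» ⇒ the two slot identities of the Hessian kernel -/

section Hessian

variable {𝕜 : Type*} [NontriviallyNormedField 𝕜] {E F : Type*} [NormedAddCommGroup E] [NormedSpace 𝕜 E]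
  [NormedAddCommGroup F] [NormedSpace 𝕜 F]

/-- **(4.9) + (4.14) ⇒ (4.15)₁ for the direction `g = ∂λ`, abstract** (p. 284): if `f` is `C²` at `0`,
infinitesimally invariant near `0` along a generator field `X` («(4.9)», `Df(B)[X(B)] = 0`) whose value at the unit
configuration is `X(0) = −g` (for the gauge action (4.8): `X_λ(0) = −∂λ`), and (4.14) `Df(0) = 0`, then
`D²f(0)(u, g) = 0` for every direction `u = B₁` — `…B12Ward414.hessian_apply_generator_eq_zero` and linearity in
the second slot. [cite: Balaban1987RG1, (4.9) p.283, (4.13)-(4.15) p.284] -/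
theorem hessian_apply_eq_zero_of_generator {f : E → F} {X : E → E} {g : E} (hf : ContDiffAt 𝕜 2 f 0)
    (hX : DifferentiableAt 𝕜 X 0) (hX0 : X 0 = -g) (hinv : ∀ᶠ B in 𝓝 (0 : E), fderiv 𝕜 f B (X B) = 0)
    (h414 : fderiv 𝕜 f 0 = 0) (u : E) : fderiv 𝕜 (fderiv 𝕜 f) 0 u g = 0 := by
  have h := hessian_apply_generator_eq_zero hf hX hinv h414 u
  rwa [hX0, map_neg, neg_eq_zero] at h

/-- **The same with (4.14) DISCHARGED** by a detecting family of LINEAR generators `L_m` (the constant gauge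
transformations; «since the configuration B₁ is arbitrary … The group G is semisimple, hence this is possible only
for the element 0», `…B12Ward414.fderiv_eq_zero_of_generators`). [cite: Balaban1987RG1, (4.13)-(4.15) p.284] -/
theorem hessian_apply_eq_zero_of_generators {Λ₀ : Type*} {f : E → F} {X : E → E} {g : E}
    (L : Λ₀ → E →L[𝕜] E) (hf : ContDiffAt 𝕜 2 f 0) (hX : DifferentiableAt 𝕜 X 0) (hX0 : X 0 = -g)
    (hinv : ∀ᶠ B in 𝓝 (0 : E), fderiv 𝕜 f B (X B) = 0)
    (hLinv : ∀ m, ∀ᶠ B in 𝓝 (0 : E), fderiv 𝕜 f B (L m B) = 0)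
    (hspan : Dense (Submodule.span 𝕜 (⋃ m, Set.range (L m)) : Set E)) (u : E) :
    fderiv 𝕜 (fderiv 𝕜 f) 0 u g = 0 :=
  hessian_apply_eq_zero_of_generator hf hX hX0 hinv (fderiv_eq_zero_of_generators L hf hLinv hspan) u

variable {Λ T V : Type*} [AddCommGroup T] [NormedAddCommGroup V] [NormedSpace 𝕜 V]
  [Fintype Λ] [Fintype T] [DecidableEq Λ] [DecidableEq T]

omit [Fintype Λ] [Fintype T] [DecidableEq Λ] in
/-- **The gradient of a delta function**: for `λ = δ_{y₀}·w` (`Pi.single y₀ w`), the `ν`-component of «∂λ»,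
`y ↦ λ(y + e_ν) − λ(y)`, is `δ_{y₀−e_ν}·w − δ_{y₀}·w`. [folklore] (about (4.8)/(4.15) pp.283-284 of Balaban1987RG1) -/
theorem grad_single (e : Λ → T) (y₀ : T) (w : V) (ν : Λ) :
    (fun y => (Pi.single y₀ w : T → V) (y + e ν) - (Pi.single y₀ w : T → V) y) =
      Pi.single (y₀ - e ν) w - Pi.single y₀ w := by
  funext y
  simp only [Pi.sub_apply, Pi.single_apply, eq_sub_iff_add_eq]

omit [Fintype T] in
/-- **(4.15)₁ ⇒ the second-slot identity, abstract finite volume**: if the Hessian of `f` at `0` annihilates every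
pure gauge `∂λ` in its second slot («⟨(δ²/δB²)𝐄(1), B₁, ∂λ⟩ = 0 … for an arbitrary gauge function λ, and arbitrary
gauge fields B₁», hypothesis `h415`), then for every direction `u` and every site `y₀` and charge direction `w`:
`Σ_ν [D²f(0)(u, e_{ν,y₀−e_ν,w}) − D²f(0)(u, e_{ν,y₀,w})] = 0` — take `λ = δ_{y₀}·w` and use linearity (no
differentiability needed). [cite: Balaban1987RG1, (4.15) p.284, (5.9) p.293] -/
theorem hessian_ward_snd {f : (Λ → T → V) → F} (e : Λ → T)
    (h415 : ∀ (u : Λ → T → V) (lam : T → V),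
      fderiv 𝕜 (fderiv 𝕜 f) 0 u (fun ν y => lam (y + e ν) - lam y) = 0)
    (u : Λ → T → V) (y₀ : T) (w : V) :
    ∑ ν, (fderiv 𝕜 (fderiv 𝕜 f) 0 u (Pi.single ν (Pi.single (y₀ - e ν) w)) -
      fderiv 𝕜 (fderiv 𝕜 f) 0 u (Pi.single ν (Pi.single y₀ w))) = 0 := by
  have hdec : (fun ν y => (Pi.single y₀ w : T → V) (y + e ν) - (Pi.single y₀ w : T → V) y) =
      ∑ ν, (Pi.single ν (Pi.single (y₀ - e ν) w - Pi.single y₀ w) : Λ → T → V) := by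
    have hg : (fun ν y => (Pi.single y₀ w : T → V) (y + e ν) - (Pi.single y₀ w : T → V) y) =
        fun ν => (Pi.single (y₀ - e ν) w - Pi.single y₀ w : T → V) := funext fun ν => grad_single e y₀ w ν
    rw [hg]
    exact (Finset.univ_sum_single fun ν => (Pi.single (y₀ - e ν) w - Pi.single y₀ w : T → V)).symm
  have h := h415 u (Pi.single y₀ w)
  rw [hdec, map_sum] at h
  simpa only [Pi.single_sub, map_sub] using h

omit [Fintype T] in
/-- **(4.15)₁ ⇒ the Ward identity of the finite-volume tensor in the SECOND variable**: for the Hessian kernel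
`H_{μν}(x, y) = δ²f/δB_μ(x)δB_ν(y)|_{B=0}` (charge direction `v`), `Σ_ν (H_{μν}(x, y − e_ν) − H_{μν}(x, y)) = 0`.
[cite: Balaban1987RG1, (4.15) p.284, (5.9) p.293] -/
theorem ward_snd_kernel {f : (Λ → T → V) → F} (e : Λ → T) (v : V)
    (h415 : ∀ (u : Λ → T → V) (lam : T → V),
      fderiv 𝕜 (fderiv 𝕜 f) 0 u (fun ν y => lam (y + e ν) - lam y) = 0)
    {H : Λ → Λ → T → T → F}
    (hH : ∀ μ ν x y,
      H μ ν x y = fderiv 𝕜 (fderiv 𝕜 f) 0 (Pi.single μ (Pi.single x v)) (Pi.single ν (Pi.single y v)))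
    (μ : Λ) (x y : T) : ∑ ν, (H μ ν x (y - e ν) - H μ ν x y) = 0 := by
  simp_rw [hH]
  exact hessian_ward_snd e h415 _ y v

/-- **(4.15)₁ ⇒ the Ward identity of the finite-volume tensor in the FIRST variable** (`𝕜 = ℝ` or `ℂ`, `f` `C²`
at `0`, so that the Hessian is symmetric — `…B12Transl58.hessian_swap`; print's `⟨D²𝐄(1); B₁, ∂λ⟩` is symmetric):
`Σ_μ (H_{μν}(x − e_μ, y) − H_{μν}(x, y)) = 0`. [cite: Balaban1987RG1, (4.15) p.284, (5.9) p.293] -/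
theorem ward_fst_kernel [IsRCLikeNormedField 𝕜] {f : (Λ → T → V) → F} (hf : ContDiffAt 𝕜 2 f 0) (e : Λ → T)
    (v : V)
    (h415 : ∀ (u : Λ → T → V) (lam : T → V),
      fderiv 𝕜 (fderiv 𝕜 f) 0 u (fun ν y => lam (y + e ν) - lam y) = 0)
    {H : Λ → Λ → T → T → F}
    (hH : ∀ μ ν x y,
      H μ ν x y = fderiv 𝕜 (fderiv 𝕜 f) 0 (Pi.single μ (Pi.single x v)) (Pi.single ν (Pi.single y v)))
    (ν : Λ) (x y : T) : ∑ μ, (H μ ν (x - e μ) y - H μ ν x y) = 0 := by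
  have hS : ∀ μ a, H μ ν a y =
      fderiv 𝕜 (fderiv 𝕜 f) 0 (Pi.single ν (Pi.single y v)) (Pi.single μ (Pi.single a v)) := fun μ a => by
    rw [hH]; exact hessian_swap hf _ _
  simp_rw [hS]
  exact hessian_ward_snd e h415 _ x v

/-- **(4.15)₁ ⇒ BOTH slot identities of the finite-volume tensor** (the finite-volume form of (5.9)), packaged.
[cite: Balaban1987RG1, (4.15) p.284, (5.9) p.293] -/
theorem ward415_finiteVolume [IsRCLikeNormedField 𝕜] {f : (Λ → T → V) → F} (hf : ContDiff 𝕜 2 f) (e : Λ → T)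
    (v : V)
    (h415 : ∀ (u : Λ → T → V) (lam : T → V),
      fderiv 𝕜 (fderiv 𝕜 f) 0 u (fun ν y => lam (y + e ν) - lam y) = 0)
    {H : Λ → Λ → T → T → F}
    (hH : ∀ μ ν x y,
      H μ ν x y = fderiv 𝕜 (fderiv 𝕜 f) 0 (Pi.single μ (Pi.single x v)) (Pi.single ν (Pi.single y v))) :
    (∀ ν x y, ∑ μ, (H μ ν (x - e μ) y - H μ ν x y) = 0) ∧ ∀ μ x y, ∑ ν, (H μ ν x (y - e ν) - H μ ν x y) = 0 :=
  ⟨ward_fst_kernel hf.contDiffAt e v h415 hH, ward_snd_kernel e v h415 hH⟩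

omit [DecidableEq Λ] [DecidableEq T] in
/-- **(4.9)/(4.14) ⇒ (4.15)₁ in the `h415` spelling, from gauge generator fields**: if for every gauge function
`λ : T → V` there is a generator field `X_λ` of the field space, differentiable at `0`, with `X_λ(0) = −∂λ` ((4.8):
«(1/i) log V^v(b) = … B(b) + i[λ(b₋), B(b)] − g⁻¹(iad_{B(b)})(∂λ)(b) + …» at `B = 0`) along which `f` is
infinitesimally invariant near `0` ((4.9)), and (4.14) `Df(0) = 0`, then `D²f(0)(u, ∂λ) = 0` for all `u`, `λ`.
[cite: Balaban1987RG1, (4.8)-(4.9) p.283, (4.14)-(4.15) p.284] -/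
theorem h415_of_gaugeGenerators {f : (Λ → T → V) → F} (hf : ContDiffAt 𝕜 2 f 0) (e : Λ → T)
    (X : (T → V) → (Λ → T → V) → (Λ → T → V)) (hX : ∀ lam, DifferentiableAt 𝕜 (X lam) 0)
    (hX0 : ∀ lam, X lam 0 = -(fun ν y => lam (y + e ν) - lam y))
    (hinv : ∀ lam, ∀ᶠ B in 𝓝 (0 : Λ → T → V), fderiv 𝕜 f B (X lam B) = 0) (h414 : fderiv 𝕜 f 0 = 0)
    (u : Λ → T → V) (lam : T → V) :
    fderiv 𝕜 (fderiv 𝕜 f) 0 u (fun ν y => lam (y + e ν) - lam y) = 0 :=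
  hessian_apply_eq_zero_of_generator hf (hX lam) (hX0 lam) (hinv lam) h414 u

end Hessian

/-! ## §3 On `Z^d`: the two-variable identities and the lineage's one-variable `WardFirst` / `WardB₂` -/

section Lattice

variable {d : ℕ} {P : Fin d → Fin d → Pt d → Pt d → ℝ}

/-- **(5.9)₁ for the one-variable kernel from the first-variable identity of the two-variable tensor**, at `y = 0`:
`Σ_μ (Π_{μν}(x − e_μ, 0) − Π_{μν}(x, 0)) = 0` is literally `WardFirst K`, `K_{μν}(z) = Π_{μν}(z, 0)` — no
translation invariance is needed in this direction. [cite: Balaban1987RG1, (5.9) p.293] -/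
theorem wardFirst_of_twoVariable (h : ∀ ν x y, ∑ μ, (P μ ν (x - unitVec μ) y - P μ ν x y) = 0) :
    WardFirst fun μ ν z => P μ ν z 0 := fun ν x => h ν x 0

/-- **Under (5.8)₁ the first-variable identity of `Π(x, y)` and `WardFirst K` are EQUIVALENT** («Σ_μ ∂*_μ Π_{μν}(x −
y) = 0» read either way). [cite: Balaban1987RG1, (5.8)-(5.9) p.293] -/
theorem twoVariable_fst_iff_wardFirst (hT : ∀ μ ν a x y, P μ ν (x + a) (y + a) = P μ ν x y) :
    (∀ ν x y, ∑ μ, (P μ ν (x - unitVec μ) y - P μ ν x y) = 0) ↔ WardFirst fun μ ν z => P μ ν z 0 := by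
  refine ⟨wardFirst_of_twoVariable, fun h ν x y => ?_⟩
  have e : ∀ μ, P μ ν (x - unitVec μ) y - P μ ν x y = P μ ν (x - y - unitVec μ) 0 - P μ ν (x - y) 0 := by
    intro μ
    rw [apply_eq_apply_sub_zero (hT μ ν) (x - unitVec μ) y, apply_eq_apply_sub_zero (hT μ ν) x y,
      sub_right_comm]
  rw [Finset.sum_congr rfl fun μ _ => e μ]
  exact h ν (x - y)

/-- **(5.9)₂ for the one-variable kernel from the second-variable identity of the two-variable tensor + (5.8)₁**:
«Σ_ν ∂_ν Π_{μν}(x − y) = 0», i.e. `Σ_ν (K_{μν}(z + e_ν) − K_{μν}(z)) = 0` (a backward step in `y` is a forward step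
in `z = x − y`). [cite: Balaban1987RG1, (5.8)-(5.9) p.293] -/
theorem wardSnd_kernel_of_twoVariable (hT : ∀ μ ν a x y, P μ ν (x + a) (y + a) = P μ ν x y)
    (h : ∀ μ x y, ∑ ν, (P μ ν x (y - unitVec ν) - P μ ν x y) = 0) (μ : Fin d) (z : Pt d) :
    ∑ ν, (P μ ν (z + unitVec ν) 0 - P μ ν z 0) = 0 := by
  have e : ∀ ν, P μ ν (z + unitVec ν) 0 = P μ ν z (0 - unitVec ν) := by
    intro ν
    rw [← hT μ ν (unitVec ν) z (0 - unitVec ν), zero_sub, neg_add_cancel]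
  simp_rw [e]
  exact h μ z 0

/-- **Under (5.8)₁ the second-variable identity of `Π(x, y)` and (5.9)₂ for `K` are EQUIVALENT.**
[cite: Balaban1987RG1, (5.8)-(5.9) p.293] -/
theorem twoVariable_snd_iff_wardSnd (hT : ∀ μ ν a x y, P μ ν (x + a) (y + a) = P μ ν x y) :
    (∀ μ x y, ∑ ν, (P μ ν x (y - unitVec ν) - P μ ν x y) = 0) ↔
      ∀ μ z, ∑ ν, (P μ ν (z + unitVec ν) 0 - P μ ν z 0) = 0 := by
  refine ⟨wardSnd_kernel_of_twoVariable hT, fun h μ x y => ?_⟩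
  have e : ∀ ν, P μ ν x (y - unitVec ν) - P μ ν x y = P μ ν (x - y + unitVec ν) 0 - P μ ν (x - y) 0 := by
    intro ν
    rw [apply_eq_apply_sub_zero (hT μ ν) x (y - unitVec ν), apply_eq_apply_sub_zero (hT μ ν) x y,
      ← sub_add]
  rw [Finset.sum_congr rfl fun ν _ => e ν]
  exact h μ (x - y)

/-- **(5.9)₂ read in `ℂ`**: the real identity `Σ_ν (K_{μν}(z + e_ν) − K_{μν}(z)) = 0` is the lineage's
`B12WardLeadingForm.WardB₂` («Σ_ν Δ_νF_{μν} = 0», forward difference `B12Rep537.fdelta`) of the complexified kernel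
`ofRealK K`. [folklore] (about (5.9)/(5.15) p.293 of Balaban1987RG1) -/
theorem wardB₂_ofRealK {K : B12Beta.Kernel d} (h : ∀ μ z, ∑ ν, (K μ ν (z + unitVec ν) - K μ ν z) = 0) :
    WardB₂ (ofRealK K) := by
  intro μ x
  have := h μ x
  simp only [fdelta, ofRealK, ofReal]
  exact_mod_cast this

variable {ι : Type*} {l : Filter ι} [l.NeBot] {Tn : ι → Type*} [∀ n, AddCommGroup (Tn n)]

/-- **(5.1) + the finite-volume slot identities ⇒ (5.9) for the two-variable tensor on `Z^d`**: if the torus kernels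
`Πv n` satisfy `Σ_μ (Πv n μ ν (x − π_n e_μ) y − Πv n μ ν x y) = 0` and `Σ_ν (Πv n μ ν x (y − π_n e_ν) − Πv n μ ν x y)
= 0` (steps = the images `π n (unitVec μ)` of the unit vectors; for Hessian kernels these are `ward415_finiteVolume`),
and `Π` is the pointwise limit (5.1) along the projections `π n : Z^d →+ Tn n` (`hlim`), then
`Σ_μ (Π_{μν}(x − e_μ, y) − Π_{μν}(x, y)) = 0` and `Σ_ν (Π_{μν}(x, y − e_ν) − Π_{μν}(x, y)) = 0`.
[cite: Balaban1987RG1, (5.1) p.292, (5.9) p.293] -/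
theorem ward59_of_limit (π : ∀ n, Pt d →+ Tn n) {Pv : ∀ n, Fin d → Fin d → Tn n → Tn n → ℝ}
    (hlim : ∀ μ ν x y, Tendsto (fun n => Pv n μ ν (π n x) (π n y)) l (𝓝 (P μ ν x y)))
    (hW1 : ∀ n ν x y, ∑ μ, (Pv n μ ν (x - π n (unitVec μ)) y - Pv n μ ν x y) = 0)
    (hW2 : ∀ n μ x y, ∑ ν, (Pv n μ ν x (y - π n (unitVec ν)) - Pv n μ ν x y) = 0) :
    (∀ ν x y, ∑ μ, (P μ ν (x - unitVec μ) y - P μ ν x y) = 0) ∧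
      ∀ μ x y, ∑ ν, (P μ ν x (y - unitVec ν) - P μ ν x y) = 0 :=
  ⟨sum_sub_fst_of_tendsto (Pn := fun n μ ν x y => Pv n μ ν (π n x) (π n y)) (fun μ x => x - unitVec μ)
      (fun n ν x y => by simpa only [map_sub] using hW1 n ν (π n x) (π n y)) hlim,
    sum_sub_snd_of_tendsto (Pn := fun n μ ν x y => Pv n μ ν (π n x) (π n y)) (fun ν y => y - unitVec ν)
      (fun n μ x y => by simpa only [map_sub] using hW2 n μ (π n x) (π n y)) hlim⟩

variable {C₁ δ₁ : ℝ} {μ₀ ν₀ : Fin d}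

/-- **END TO END, v3 of `…B12EuclCov567.moment2_eq_of_limit_cov` with (5.9)₁ DISCHARGED from finite volume**:
(5.1) + finite-volume translation invariance, symmetry, `r_π`- and `ε`-covariance and the FIRST-VARIABLE Ward
identity of the torus kernels + for `K = Π(·, 0)` ONLY the decay (5.10) `Decay510` ⇒ (4.43)
`Σ_y Π_{μν}(x, y)(y_κ − x_κ)(y_τ − x_τ) = β(δ_{μκ}δ_{ντ} + δ_{μτ}δ_{νκ} − 2δ_{μν}δ_{κτ})`, `β = Σ_z K_{μ₀ν₀}(z)z_{μ₀}z_{ν₀}`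
(`μ₀ ≠ ν₀`), (4.45) `Σ_y Π_{μν}(x, y)(y_κ − x_κ) = 0` and `Σ_y Π_{μν}(x, y) = 0`.
[cite: Balaban1987RG1, (5.1)-(5.6) p.292, (5.7)-(5.10) p.293, (4.43) p.291, (4.45) p.292, (5.42) p.297] -/
theorem moment2_eq_of_limit_ward (π : ∀ n, Pt d →+ Tn n) {Pv : ∀ n, Fin d → Fin d → Tn n → Tn n → ℝ}
    (hTv : ∀ n μ ν b x y, Pv n μ ν (x + b) (y + b) = Pv n μ ν x y)
    (hSv : ∀ n μ ν x y, Pv n μ ν x y = Pv n ν μ y x)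
    (hlim : ∀ μ ν x y, Tendsto (fun n => Pv n μ ν (π n x) (π n y)) l (𝓝 (P μ ν x y)))
    (rn : ∀ n, Equiv.Perm (Fin d) → Tn n → Tn n) (hπr : ∀ n σ x, π n (permPt σ x) = rn n σ (π n x))
    (hPermv : ∀ n (σ : Equiv.Perm (Fin d)) μ ν x y, Pv n (σ μ) (σ ν) (rn n σ x) (rn n σ y) = Pv n μ ν x y)
    (tn : ∀ n, Fin d → Fin d → Tn n → Tn n) (hπt : ∀ n ρ ν x, π n (twist ρ ν x) = tn n ρ ν (π n x))
    (hReflv : ∀ n ρ μ ν x y, Pv n μ ν (tn n ρ μ x) (tn n ρ ν y) = rsgn ρ μ * rsgn ρ ν * Pv n μ ν x y)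
    (hW1 : ∀ n ν x y, ∑ μ, (Pv n μ ν (x - π n (unitVec μ)) y - Pv n μ ν x y) = 0)
    (hδ : 0 < δ₁) (h510 : ∀ μ ν, Decay510 (fun z => P μ ν z 0) C₁ δ₁) (h0 : μ₀ ≠ ν₀) (x : Pt d)
    (μ ν κ τ : Fin d) :
    ∑' y, P μ ν x y * (((y κ - x κ : ℤ) : ℝ) * ((y τ - x τ : ℤ) : ℝ)) =
        B12Beta.secondMoment (fun μ ν z => P μ ν z 0) μ₀ ν₀ *
          (kdA μ κ * kdA ν τ + kdA μ τ * kdA ν κ - 2 * kdA μ ν * kdA κ τ) ∧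
      ∑' y, P μ ν x y * ((y κ - x κ : ℤ) : ℝ) = 0 ∧ ∑' y, P μ ν x y = 0 :=
  moment2_eq_of_limit_cov π hTv hSv hlim rn hπr hPermv tn hπt hReflv hδ h510
    (wardFirst_of_twoVariable
      (sum_sub_fst_of_tendsto (Pn := fun n μ ν x y => Pv n μ ν (π n x) (π n y)) (fun μ x => x - unitVec μ)
        (fun n ν x y => by simpa only [map_sub] using hW1 n ν (π n x) (π n y)) hlim))
    h0 x μ ν κ τ

end Lattice

/-! ## §4 From the functional: (4.15)₁ for the `C²` functions `𝐄^{(j)}(U_j(exp iB))` on the tori ⇒ (5.9) for the limit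
(5.1) on `Z^d`, and (4.43) with `hward` discharged -/

section Functional

variable {d : ℕ} {V : Type*} [NormedAddCommGroup V] [NormedSpace ℝ V]
  {P : Fin d → Fin d → Pt d → Pt d → ℝ} {ι : Type*} {l : Filter ι} [l.NeBot] {Tn : ι → Type*}
  [∀ n, AddCommGroup (Tn n)] [∀ n, Fintype (Tn n)] [∀ n, DecidableEq (Tn n)]

/-- **(4.15)₁ on the tori + (5.1) ⇒ (5.9) on `Z^d`**: for every volume `n` a `C²` function `f n` of the bond field
`B : Fin d → Tn n → V` (print's `B ↦ 𝐄^{(j)}(U_j(exp iB))`) whose Hessian at `0` annihilates every pure gauge `∂λ`,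
`(∂λ)_ν(y) = λ(y + π_n e_ν) − λ(y)` («⟨(δ²/δB²)𝐄(1), B₁, ∂λ⟩ = 0 … for an arbitrary gauge function λ, and arbitrary
gauge fields B₁», hypothesis `h415`), `Πv n` ITS Hessian kernel at `B = 0` (charge direction `v`), and the pointwise
limit (5.1) `Π` (`hlim`) ⇒ «Σ_μ ∂*_μ Π_{μν}(x − y) = Σ_ν ∂_ν Π_{μν}(x − y) = 0» as the two two-variable identities, and
`WardFirst K` for `K = Π(·, 0)`. [cite: Balaban1987RG1, (4.15) p.284, (5.1) p.292, (5.9) p.293] -/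
theorem ward59_of_limit_of_gaugeInvariance (π : ∀ n, Pt d →+ Tn n) {f : ∀ n, (Fin d → Tn n → V) → ℝ}
    (hf : ∀ n, ContDiff ℝ 2 (f n)) (v : V) {Pv : ∀ n, Fin d → Fin d → Tn n → Tn n → ℝ}
    (hH : ∀ n μ ν x y, Pv n μ ν x y =
      fderiv ℝ (fderiv ℝ (f n)) 0 (Pi.single μ (Pi.single x v)) (Pi.single ν (Pi.single y v)))
    (hlim : ∀ μ ν x y, Tendsto (fun n => Pv n μ ν (π n x) (π n y)) l (𝓝 (P μ ν x y)))
    (h415 : ∀ n (u : Fin d → Tn n → V) (lam : Tn n → V),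
      fderiv ℝ (fderiv ℝ (f n)) 0 u (fun ν y => lam (y + π n (unitVec ν)) - lam y) = 0) :
    (∀ ν x y, ∑ μ, (P μ ν (x - unitVec μ) y - P μ ν x y) = 0) ∧
      (∀ μ x y, ∑ ν, (P μ ν x (y - unitVec ν) - P μ ν x y) = 0) ∧ WardFirst fun μ ν z => P μ ν z 0 := by
  obtain ⟨h1, h2⟩ := ward59_of_limit π hlim
    (fun n => ward_fst_kernel (hf n).contDiffAt (fun μ => π n (unitVec μ)) v (h415 n) (hH n))
    (fun n => ward_snd_kernel (fun μ => π n (unitVec μ)) v (h415 n) (hH n))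
  exact ⟨h1, h2, wardFirst_of_twoVariable h1⟩

/-- **(5.9), BOTH identities for the one-variable kernel, from the functional**: adding the translation invariance
of `f n` ((5.2) for the translations; `…B12Transl58.eq121_finiteVolume`, `transl58_of_limit` give (5.8)₁ on `Z^d`):
(5.9)₁ `WardFirst K` and (5.9)₂ `Σ_ν (K_{μν}(z + e_ν) − K_{μν}(z)) = 0`, with their complex readings `WardB (ofRealK K)`,
`WardB₂ (ofRealK K)` (the hypotheses of the lineage's momentum-space modules).
[cite: Balaban1987RG1, (4.15) p.284, (5.1)-(5.2) p.292, (5.8)-(5.9) p.293] -/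
theorem eq59_of_limit_of_gaugeInvariance (π : ∀ n, Pt d →+ Tn n) {f : ∀ n, (Fin d → Tn n → V) → ℝ}
    (hf : ∀ n, ContDiff ℝ 2 (f n)) (v : V) {Pv : ∀ n, Fin d → Fin d → Tn n → Tn n → ℝ}
    (hH : ∀ n μ ν x y, Pv n μ ν x y =
      fderiv ℝ (fderiv ℝ (f n)) 0 (Pi.single μ (Pi.single x v)) (Pi.single ν (Pi.single y v)))
    (hlim : ∀ μ ν x y, Tendsto (fun n => Pv n μ ν (π n x) (π n y)) l (𝓝 (P μ ν x y)))
    (hftransl : ∀ n (a : Tn n) (B : Fin d → Tn n → V), f n (fun μ y => B μ (y - a)) = f n B)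
    (h415 : ∀ n (u : Fin d → Tn n → V) (lam : Tn n → V),
      fderiv ℝ (fderiv ℝ (f n)) 0 u (fun ν y => lam (y + π n (unitVec ν)) - lam y) = 0) :
    WardFirst (fun μ ν z => P μ ν z 0) ∧ (∀ μ z, ∑ ν, (P μ ν (z + unitVec ν) 0 - P μ ν z 0) = 0) ∧
      WardB (ofRealK fun μ ν z => P μ ν z 0) ∧ WardB₂ (ofRealK fun μ ν z => P μ ν z 0) := by
  obtain ⟨hT, _⟩ := transl58_of_limit π (fun n => (eq121_finiteVolume (hf n) (hftransl n) v (hH n)).1)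
    (fun n => (eq121_finiteVolume (hf n) (hftransl n) v (hH n)).2.1) hlim
  obtain ⟨h1, h2, hW⟩ := ward59_of_limit_of_gaugeInvariance π hf v hH hlim h415
  have hW2 : ∀ μ z, ∑ ν, (P μ ν (z + unitVec ν) 0 - P μ ν z 0) = 0 := wardSnd_kernel_of_twoVariable hT h2
  exact ⟨hW, hW2, wardB_ofReal hW, wardB₂_ofRealK (K := fun μ ν z => P μ ν z 0) hW2⟩

variable {C₁ δ₁ : ℝ} {μ₀ ν₀ : Fin d}

/-- **END TO END FROM (5.2) AND (4.15)₁: (4.43), (4.45) and `Σ_y Π = 0` for the limit tensor**, with the Ward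
hypothesis `hward` of `…B12EuclCov567.moment2_eq_of_limit_of_invariance` DISCHARGED — per volume a `C²` function
`f n` of the bond field invariant under translations, direction permutations and reflections (5.2)/(5.3) and
satisfying the first Ward–Takahashi identity (4.15)₁ (`h415`), `Πv n` its Hessian kernel at `0`, intertwining
projections, the pointwise limit (5.1), and for `K = Π(·, 0)` ONLY the decay (5.10) `Decay510` ((4.37)) ⇒
`Σ_y Π_{μν}(x, y)(y_κ − x_κ)(y_τ − x_τ) = β(δ_{μκ}δ_{ντ} + δ_{μτ}δ_{νκ} − 2δ_{μν}δ_{κτ})`, `Σ_y Π_{μν}(x, y)(y_κ − x_κ) = 0`,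
`Σ_y Π_{μν}(x, y) = 0`. [cite: Balaban1987RG1, (4.15) p.284, (5.1)-(5.6) p.292, (5.7)-(5.10) p.293, (4.43) p.291,
(4.45) p.292; (1.20)-(1.22) p.264] -/
theorem moment2_eq_of_limit_of_gaugeInvariance (π : ∀ n, Pt d →+ Tn n) {f : ∀ n, (Fin d → Tn n → V) → ℝ}
    (hf : ∀ n, ContDiff ℝ 2 (f n)) (v : V) {Pv : ∀ n, Fin d → Fin d → Tn n → Tn n → ℝ}
    (hH : ∀ n μ ν x y, Pv n μ ν x y =
      fderiv ℝ (fderiv ℝ (f n)) 0 (Pi.single μ (Pi.single x v)) (Pi.single ν (Pi.single y v)))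
    (hlim : ∀ μ ν x y, Tendsto (fun n => Pv n μ ν (π n x) (π n y)) l (𝓝 (P μ ν x y)))
    (hftransl : ∀ n (a : Tn n) (B : Fin d → Tn n → V), f n (fun μ y => B μ (y - a)) = f n B)
    (rn : ∀ n, Equiv.Perm (Fin d) → Tn n ≃ Tn n) (hπr : ∀ n σ x, π n (permPt σ x) = rn n σ (π n x))
    (hfperm : ∀ n (σ : Equiv.Perm (Fin d)) (B : Fin d → Tn n → V),
      f n (fun ν y => B (σ.symm ν) ((rn n σ).symm y)) = f n B)
    (tn : ∀ n, Fin d → Fin d → Tn n ≃ Tn n) (hπt : ∀ n ρ ν x, π n (twist ρ ν x) = tn n ρ ν (π n x))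
    (hfrefl : ∀ n ρ (B : Fin d → Tn n → V), f n (fun ν y => rsgn ρ ν • B ν (tn n ρ ν y)) = f n B)
    (h415 : ∀ n (u : Fin d → Tn n → V) (lam : Tn n → V),
      fderiv ℝ (fderiv ℝ (f n)) 0 u (fun ν y => lam (y + π n (unitVec ν)) - lam y) = 0)
    (hδ : 0 < δ₁) (h510 : ∀ μ ν, Decay510 (fun z => P μ ν z 0) C₁ δ₁) (h0 : μ₀ ≠ ν₀) (x : Pt d)
    (μ ν κ τ : Fin d) :
    ∑' y, P μ ν x y * (((y κ - x κ : ℤ) : ℝ) * ((y τ - x τ : ℤ) : ℝ)) =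
        B12Beta.secondMoment (fun μ ν z => P μ ν z 0) μ₀ ν₀ *
          (kdA μ κ * kdA ν τ + kdA μ τ * kdA ν κ - 2 * kdA μ ν * kdA κ τ) ∧
      ∑' y, P μ ν x y * ((y κ - x κ : ℤ) : ℝ) = 0 ∧ ∑' y, P μ ν x y = 0 :=
  moment2_eq_of_limit_of_invariance π hf v hH hlim hftransl rn hπr hfperm tn hπt hfrefl hδ h510
    (ward59_of_limit_of_gaugeInvariance π hf v hH hlim h415).2.2 h0 x μ ν κ τ

end Functional

end Literature.MathematicalPhysics.QuantumFieldTheory.Balaban1983to89.B12Ward59
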